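import Literature.NumberTheory.Automorphic.OrbitalIntegralLocallyConstantChart   -- ★ §2 tube lemma `exists_nhds_forall_eq_of_isLocallyConstant`
import HarnessLib

/-!
# The elliptic reading of a coefficient orbital function: `χ(γ₀) = c · ∫_G u(x γ₀ x⁻¹) dν(x)` from a trace identity, by uniform
# compactness, the tube lemma and Fubini (generic layer; Harish-Chandra's «character of a supercusp form»)

Topic `NumberTheory/Automorphic`; namespace `Literature.NumberTheory.Automorphic`. THEOREMS ONLY (no definition, no instance, no notation, no named
fact, no `sorry`). Cell `pub/hodgecm-mathlib`, generic base-layer brick «ELL-READING CORE» for census HC-SC v1 §2 E2-4 (count-neutral, no road implied).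

THE MATHEMATICS [HarishChandra1970, Part V §4, Lemma 23 and Theorem 12 (pp. 57–62): for a supercuspidal `π` with `K`-finite unit vector `φ` and
coefficient `θ(y) = (φ, π(y)φ)`, the function `F_Γ(γ) = d(π) ∫_{G∕Z} dx* ∫_{K₀} θ(γ^{xk}) dk` exists and is locally constant on `Γ'` (Lemma 23: the
`x`-support is compact mod `Z`, uniformly for `γ` in a compact subset of `Γ'`), and the character `Θ_π` IS this orbital function of `θ` on the regular set
(Theorem 12); Rogawski1990 §12.6 p. 187 (pseudo-coefficients of supercuspidals are matrix coefficients)]. `G` a topological group with a measure `ν`; `u : G → ℂ`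
LOCALLY CONSTANT («the matrix coefficient», compactly supported in the application); `χ : G → ℂ` («the character»), `c : ℂ` («`d(π)∕‖v‖²`»), `γ₀ ∈ G`
(«an elliptic regular element»); `U(g) := ∫_G u(x g x⁻¹) dν(x)` the ORBITAL FUNCTION of `u`. Three inputs, all hypotheses here:
* (UC) UNIFORM COMPACTNESS near `γ₀`: an open `C₀ ∋ γ₀` and a compact `S ⊆ G` with `u(x g x⁻¹) = 0` for `g ∈ C₀`, `x ∉ S` (Lemma 23; for a compact
  centraliser `Z(γ₀)` this is ★ `ConjugationProperOnRegularCompacta` read at a `G`-neighbourhood of `γ₀`);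
* (LCχ) `χ` is constant on `C₀`;
* (T2) the TRACE IDENTITY `∫_C χ dν = c · ∫_x ∫_{g ∈ C} u(x g x⁻¹) dν dν` for compact open `γ₀ ∈ C ⊆ C₀` (= «`Tr π(𝟙_C) = ∫ 𝟙_C χ_π`» ∘ «`Tr π(φ) =
  c ∫_x ∫_g φ(g) u(x g x⁻¹)`», census E2-2 (T2)).
CONCLUSION `χ(γ₀) = c · U(γ₀)`. PROOF: §1 `(x, g) ↦ u(x g x⁻¹)` is locally constant on `G × G`, so (★ tube lemma over the compact `S`) `u(x g x⁻¹) =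
u(x γ₀ x⁻¹)` for ALL `x` once `g ∈ C₀` is near `γ₀` (off `S` both sides vanish by (UC)) — in particular `U` is constant near `γ₀` inside `C₀`; §2 the
integrand `(x, g) ↦ 𝟙_C(g) u(x g x⁻¹)` is the indicator of the compact `S ×ˢ C` times a continuous function, hence integrable on `G × G`; §3 Fubini:
`χ(γ₀) ν(C) = c ∫_{g ∈ C} U(g) dν = c U(γ₀) ν(C)`, and `0 < ν(C) < ∞`; §4 the package (shrink `C₀` to a compact open `C` inside the tube, `G` locally
compact totally disconnected).

* §1 `exists_nhds_forall_conj_eq_of_isLocallyConstant_of_isCompact` ∕ `exists_nhds_forall_integral_conj_eq_of_isLocallyConstant_of_isCompact`;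
* §2 `integrable_indicator_mul_conj_prod_of_isCompact`;
* §3 `eq_mul_integral_conj_of_setIntegral_eq`;
* §4 **`eq_mul_integral_conj_of_forall_setIntegral_eq`** (the head).
NOT here: the production of (UC) at an elliptic regular class of `U(Φ₃)(L⁺_v)` (★ uniform compactness + the Cayley chart), of (LCχ) (the `hchar` pin), of
(T2) (census E2-2), and the canonical-family reading `Φ(⟦γ₀⟧, ·) = ∫_G ·(x γ₀ x⁻¹) dν` (★ `ArchTorusOrbitalFunctionAtPoint`) — the CM dress is a separate file.
HONEST LABEL: HC_CM is proved only modulo the printed citations until rung 0 closes; this file is measure theory and pays nothing by itself.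

## References
* [HarishChandra1970] Harish-Chandra (notes by G. van Dijk), *Harmonic Analysis on Reductive p-adic Groups*, LNM 162 (1970), Part I §3 (uniform
  compactness, Lemmas 13–14) and Part V §4 «Applications to the characters of the supercuspidal representations», Lemma 23, Theorem 12 (pp. 57–62).
* [Rogawski1990] J. D. Rogawski, *Automorphic Representations of Unitary Groups in Three Variables*, Ann. of Math. Stud. 123 (1990), §12.6 p. 187.
-/

set_option autoImplicit false

noncomputable section

open MeasureTheory Measure Set Filter Topology

namespace Literature.NumberTheory.Automorphic

/-! ## §1 Uniform compactness + local constancy: the integrands `x ↦ u(x g x⁻¹)` do not depend on `g ∈ C₀` near `γ₀` -/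

section Tube

variable {G : Type*} [Group G] [TopologicalSpace G] [IsTopologicalGroup G] {Y : Type*}

/-- **The orbital integrands of a locally constant `u` are locally constant in the group variable, as functions on `G`** (uniform compactness ⇒
local constancy, `G`-neighbourhood form). `u` locally constant; (UC) `S` compact with `u(x g x⁻¹) = 0` for `g ∈ C`, `x ∉ S`; `γ₀ ∈ C`. Then there is a
neighbourhood `W` of `γ₀` in `G` with `u(x g x⁻¹) = u(x γ₀ x⁻¹)` for EVERY `x ∈ G` and every `g ∈ W ∩ C` (★ tube lemma `exists_nhds_forall_eq_of_isLocallyConstant`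
for `(x, g) ↦ u(x g x⁻¹)` over the compact `S`; off `S` both sides vanish). [cite: HarishChandra1970, Part V §4 Lemma 23 (pp. 57–62)] -/
theorem exists_nhds_forall_conj_eq_of_isLocallyConstant_of_isCompact [Zero Y] {u : G → Y} (hu : IsLocallyConstant u)
    {C S : Set G} (hS : IsCompact S) (hCS : ∀ g ∈ C, ∀ x : G, x ∉ S → u (x * g * x⁻¹) = 0) {γ₀ : G} (hγ₀ : γ₀ ∈ C) :
    ∃ W ∈ 𝓝 γ₀, ∀ g ∈ W, g ∈ C → ∀ x : G, u (x * g * x⁻¹) = u (x * γ₀ * x⁻¹) := by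
  have hF : IsLocallyConstant (u ∘ fun p : G × G => p.1 * p.2 * p.1⁻¹) :=
    hu.comp_continuous ((continuous_fst.mul continuous_snd).mul continuous_fst.inv)
  obtain ⟨W, hW, hconst⟩ := exists_nhds_forall_eq_of_isLocallyConstant _ hF hS γ₀
  refine ⟨W, hW, fun g hgW hgC x => ?_⟩
  by_cases hx : x ∈ S
  · exact hconst x hx g hgW
  · rw [hCS g hgC x hx, hCS γ₀ hγ₀ x hx]

/-- The integrated form of ★ `exists_nhds_forall_conj_eq_of_isLocallyConstant_of_isCompact`: for ANY measure `ν` on `G`, the ORBITAL FUNCTION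
`U(g) = ∫_G u(x g x⁻¹) dν(x)` satisfies `U(g) = U(γ₀)` for `g ∈ W ∩ C`, `W` a neighbourhood of `γ₀` («`F_Γ` is locally constant»). [cite: HarishChandra1970, Part V §4 Lemma 23 (pp. 57–62)] -/
theorem exists_nhds_forall_integral_conj_eq_of_isLocallyConstant_of_isCompact [NormedAddCommGroup Y] [NormedSpace ℝ Y] [MeasurableSpace G]
    (ν : Measure G) {u : G → Y} (hu : IsLocallyConstant u)
    {C S : Set G} (hS : IsCompact S) (hCS : ∀ g ∈ C, ∀ x : G, x ∉ S → u (x * g * x⁻¹) = 0) {γ₀ : G} (hγ₀ : γ₀ ∈ C) :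
    ∃ W ∈ 𝓝 γ₀, ∀ g ∈ W, g ∈ C → ∫ x, u (x * g * x⁻¹) ∂ν = ∫ x, u (x * γ₀ * x⁻¹) ∂ν := by
  obtain ⟨W, hW, h⟩ := exists_nhds_forall_conj_eq_of_isLocallyConstant_of_isCompact hu hS hCS hγ₀
  refine ⟨W, hW, fun g hgW hgC => ?_⟩
  exact integral_congr_ae (Filter.Eventually.of_forall fun x => h g hgW hgC x)

end Tube

/-! ## §2 Integrability of `(x, g) ↦ 𝟙_C(g) u(x g x⁻¹)` on `G × G` under uniform compactness -/

section Integrable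

variable {G : Type*} [Group G] [TopologicalSpace G] [IsTopologicalGroup G] [T2Space G] [SecondCountableTopology G]
  [MeasurableSpace G] [OpensMeasurableSpace G]

/-- **Fubini's hypothesis from uniform compactness.** `u : G → ℂ` locally constant, `C` compact, (UC) `S` compact with `u(x g x⁻¹) = 0` for `g ∈ C`,
`x ∉ S`: the function `(x, g) ↦ 𝟙_C(g) · u(x g x⁻¹)` is the indicator of the compact `S ×ˢ C` applied to the continuous `(x, g) ↦ u(x g x⁻¹)`, hence
integrable for `μ ⊗ ν` whenever `μ`, `ν` are finite on compacta. [cite: HarishChandra1970, Part V §4 Lemma 23 (pp. 57–62)] -/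
theorem integrable_indicator_mul_conj_prod_of_isCompact (μ ν : Measure G) [IsFiniteMeasureOnCompacts μ] [IsFiniteMeasureOnCompacts ν]
    {u : G → ℂ} (hu : IsLocallyConstant u) {C S : Set G} (hC : IsCompact C) (hS : IsCompact S)
    (hCS : ∀ g ∈ C, ∀ x : G, x ∉ S → u (x * g * x⁻¹) = 0) :
    Integrable (fun p : G × G => C.indicator (fun _ => (1 : ℂ)) p.2 * u (p.1 * p.2 * p.1⁻¹)) (μ.prod ν) := by
  have hcont : Continuous fun p : G × G => u (p.1 * p.2 * p.1⁻¹) :=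
    hu.continuous.comp ((continuous_fst.mul continuous_snd).mul continuous_fst.inv)
  have heq : (fun p : G × G => C.indicator (fun _ => (1 : ℂ)) p.2 * u (p.1 * p.2 * p.1⁻¹))
      = (S ×ˢ C).indicator fun p : G × G => u (p.1 * p.2 * p.1⁻¹) := by
    funext p
    by_cases h2 : p.2 ∈ C
    · by_cases h1 : p.1 ∈ S
      · rw [Set.indicator_of_mem h2, Set.indicator_of_mem (Set.mk_mem_prod h1 h2), one_mul]
      · rw [Set.indicator_of_notMem (fun h : p ∈ S ×ˢ C => h1 h.1), hCS p.2 h2 p.1 h1, mul_zero]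
    · rw [Set.indicator_of_notMem h2, Set.indicator_of_notMem (fun h : p ∈ S ×ˢ C => h2 h.2), zero_mul]
  rw [heq, integrable_indicator_iff (hS.prod hC).measurableSet]
  exact hcont.continuousOn.integrableOn_compact (hS.prod hC)

end Integrable

/-! ## §3 The Fubini step: `χ(γ₀) ν(C) = c · U(γ₀) ν(C)` -/

section Fubini

variable {G : Type*} [Group G] [MeasurableSpace G]

/-- **THE ELLIPTIC READING, FUBINI STEP.** `C` measurable with `0 < ν(C) < ∞`; (T2) `∫_C χ dν = c ∫_x ∫_{g ∈ C} u(x g x⁻¹) dν dν`; `χ ≡ χ(γ₀)` on `C`;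
the orbital function `U(g) = ∫ u(x g x⁻¹) dν(x)` satisfies `U ≡ U(γ₀)` on `C`; `(x, g) ↦ 𝟙_C(g) u(x g x⁻¹)` integrable on `G × G`. Then
`χ(γ₀) = c · U(γ₀)`: the left side of (T2) is `ν(C) χ(γ₀)`, the right side is (Fubini ★ Mathlib `integral_integral_swap`) `c ∫_{g ∈ C} U(g) dν =
c ν(C) U(γ₀)`; cancel `ν(C) ≠ 0`. [cite: HarishChandra1970, Part V §4 Thm. 12 (pp. 57–62)] [cite: Rogawski1990, §12.6 p. 187] -/
theorem eq_mul_integral_conj_of_setIntegral_eq (ν : Measure G) [SFinite ν] {u χ : G → ℂ} {c : ℂ} {C : Set G} {γ₀ : G}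
    (hCm : MeasurableSet C) (hC0 : ν C ≠ 0) (hCtop : ν C ≠ ⊤)
    (hT : ∫ g in C, χ g ∂ν = c * ∫ x, ∫ g in C, u (x * g * x⁻¹) ∂ν ∂ν)
    (hχ : ∀ g ∈ C, χ g = χ γ₀)
    (hU : ∀ g ∈ C, ∫ x, u (x * g * x⁻¹) ∂ν = ∫ x, u (x * γ₀ * x⁻¹) ∂ν)
    (hint : Integrable (fun p : G × G => C.indicator (fun _ => (1 : ℂ)) p.2 * u (p.1 * p.2 * p.1⁻¹)) (ν.prod ν)) :
    χ γ₀ = c * ∫ x, u (x * γ₀ * x⁻¹) ∂ν := by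
  -- the indicator bookkeeping `∫_{g ∈ C} F g = ∫_g 𝟙_C(g) · F g`
  have hind : ∀ F : G → ℂ, ∫ g in C, F g ∂ν = ∫ g, C.indicator (fun _ => (1 : ℂ)) g * F g ∂ν := fun F => by
    rw [← integral_indicator hCm]
    refine integral_congr_ae (Filter.Eventually.of_forall fun g => ?_)
    change C.indicator F g = C.indicator (fun _ => (1 : ℂ)) g * F g
    by_cases hg : g ∈ C
    · rw [Set.indicator_of_mem hg, Set.indicator_of_mem hg, one_mul]
    · rw [Set.indicator_of_notMem hg, Set.indicator_of_notMem hg, zero_mul]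
  -- left side of (T2)
  have hL : ∫ g in C, χ g ∂ν = (ν.real C : ℂ) * χ γ₀ := by
    rw [setIntegral_congr_fun hCm fun g hg => hχ g hg, setIntegral_const, Complex.real_smul]
  -- right side of (T2): swap and read `U ≡ U(γ₀)` on `C`
  have hR : ∫ x, ∫ g in C, u (x * g * x⁻¹) ∂ν ∂ν = (ν.real C : ℂ) * ∫ x, u (x * γ₀ * x⁻¹) ∂ν := by
    have h1 : (fun x => ∫ g in C, u (x * g * x⁻¹) ∂ν) = fun x => ∫ g, C.indicator (fun _ => (1 : ℂ)) g * u (x * g * x⁻¹) ∂ν := by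
      funext x
      exact hind _
    rw [h1, integral_integral_swap hint]
    have h2 : (fun g => ∫ x, C.indicator (fun _ => (1 : ℂ)) g * u (x * g * x⁻¹) ∂ν)
        = fun g => C.indicator (fun _ => (1 : ℂ)) g * ∫ x, u (x * g * x⁻¹) ∂ν := by
      funext g
      exact integral_const_mul _ _
    rw [h2, ← hind, setIntegral_congr_fun hCm fun g hg => hU g hg, setIntegral_const, Complex.real_smul]
  have hreal : (ν.real C : ℂ) ≠ 0 := by
    rw [Ne, Complex.ofReal_eq_zero, measureReal_eq_zero_iff hCtop]
    exact hC0
  rw [hL, hR, ← mul_assoc, mul_comm c, mul_assoc] at hT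
  exact mul_left_cancel₀ hreal hT

end Fubini

/-! ## §4 The package: shrink to a compact open neighbourhood inside the tube -/

section Package

variable {G : Type*} [Group G] [TopologicalSpace G] [IsTopologicalGroup G] [T2Space G] [SecondCountableTopology G]
  [LocallyCompactSpace G] [TotallyDisconnectedSpace G] [MeasurableSpace G] [OpensMeasurableSpace G]

/-- **THE ELLIPTIC READING OF A COEFFICIENT ORBITAL FUNCTION** (Harish-Chandra). `G` locally compact, Hausdorff, second countable, totally
disconnected; `ν` s-finite, finite on compacta, positive on opens; `u : G → ℂ` locally constant; `γ₀ ∈ C₀` open; (UC) `S` compact with `u(x g x⁻¹) = 0`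
for `g ∈ C₀`, `x ∉ S`; (LCχ) `χ ≡ χ(γ₀)` on `C₀`; (T2) for every compact open `C` with `γ₀ ∈ C ⊆ C₀`: `∫_C χ dν = c ∫_x ∫_{g ∈ C} u(x g x⁻¹) dν(g) dν(x)`.
Then `χ(γ₀) = c · ∫_G u(x γ₀ x⁻¹) dν(x)` (§1 tube `W`; a compact open `γ₀ ∈ C ⊆ C₀ ∩ W` from the clopen basis ★ Mathlib `loc_compact_Haus_tot_disc_of_zero_dim`
inside a compact neighbourhood; §2 integrability; §3). [cite: HarishChandra1970, Part V §4 Lemma 23, Thm. 12 (pp. 57–62)] [cite: Rogawski1990, §12.6 p. 187] -/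
theorem eq_mul_integral_conj_of_forall_setIntegral_eq (ν : Measure G) [SFinite ν] [IsFiniteMeasureOnCompacts ν] [ν.IsOpenPosMeasure]
    {u χ : G → ℂ} (hu : IsLocallyConstant u) {c : ℂ} {C₀ S : Set G} {γ₀ : G} (hC₀ : IsOpen C₀) (hγ₀ : γ₀ ∈ C₀)
    (hS : IsCompact S) (hCS : ∀ g ∈ C₀, ∀ x : G, x ∉ S → u (x * g * x⁻¹) = 0)
    (hχ : ∀ g ∈ C₀, χ g = χ γ₀)
    (hT : ∀ C : Set G, C ⊆ C₀ → IsCompact C → IsOpen C → γ₀ ∈ C →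
      ∫ g in C, χ g ∂ν = c * ∫ x, ∫ g in C, u (x * g * x⁻¹) ∂ν ∂ν) :
    χ γ₀ = c * ∫ x, u (x * γ₀ * x⁻¹) ∂ν := by
  -- §1: the tube
  obtain ⟨W, hW, hconst⟩ := exists_nhds_forall_integral_conj_eq_of_isLocallyConstant_of_isCompact ν hu hS hCS hγ₀
  -- a compact open `C` with `γ₀ ∈ C ⊆ C₀ ∩ W`
  obtain ⟨K, hK, hKγ⟩ := exists_compact_mem_nhds γ₀
  have hO : IsOpen (interior K ∩ interior W ∩ C₀) := (isOpen_interior.inter isOpen_interior).inter hC₀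
  have hγO : γ₀ ∈ interior K ∩ interior W ∩ C₀ :=
    ⟨⟨mem_interior_iff_mem_nhds.2 hKγ, mem_interior_iff_mem_nhds.2 hW⟩, hγ₀⟩
  obtain ⟨C, hCclopen, hγC, hCO⟩ :=
    (loc_compact_Haus_tot_disc_of_zero_dim (H := G)).exists_subset_of_mem_open hγO hO
  have hCK : C ⊆ K := fun g hg => interior_subset (hCO hg).1.1
  have hCW : C ⊆ W := fun g hg => interior_subset (hCO hg).1.2
  have hCC₀ : C ⊆ C₀ := fun g hg => (hCO hg).2
  have hCcpt : IsCompact C := hK.of_isClosed_subset hCclopen.1 hCK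
  -- §3 with §2
  refine eq_mul_integral_conj_of_setIntegral_eq ν hCclopen.2.measurableSet (hCclopen.2.measure_ne_zero ν ⟨γ₀, hγC⟩)
    hCcpt.measure_lt_top.ne (hT C hCC₀ hCcpt hCclopen.2 hγC) (fun g hg => hχ g (hCC₀ hg))
    (fun g hg => hconst g (hCW hg) (hCC₀ hg)) ?_
  exact integrable_indicator_mul_conj_prod_of_isCompact ν ν hu hCcpt hS fun g hg x hx => hCS g (hCC₀ hg) x hx

end Package

end Literature.NumberTheory.Automorphic

end
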